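import Mathlib
import HarnessLib

/-!
# Route `KLProgramme`, crux K3 `KLRegimeTwoPointLimit` — vanishing-order bounds for holomorphic functions of one and two complex
# parameters (the engine of Lemma E.5d: the non-ladder four-legged remainder is CUBIC in the couplings)
# (cell gate-hubbard-kl, seat p1 = C1 `BetaSplit` lead, generation 4; HOME/p1/E5D-NOTE.md §1, §4 «CauchyTwoParamCubic»)

Lemma E.5d of the cell's crux decomposition turns the QUADRATIC bound of Feldman–Knörrer–Trubowitz's overlapping-loop theorem
[FKTr2, Thm VI (ii)] into a CUBIC bound on the non-ladder four-legged output, by applying the theorem to the two-parameter family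
`W^{[t,s]} = t·W₄ + s·W_{≥6}` on a polydisc `|t| ≤ T ≍ 1/U`, `|s| ≤ S ≍ 1/U²`, where the bound is a constant `M`, and using that the
Taylor coefficients `A₀₀, A₁₀, A₀₁, A₂₀` of `(t,s) ↦ Φ(W^{[t,s]})` vanish identically (Wick ordering; second order in the quartic part is
exactly the ladders).  The complex-analysis engine is elementary and model-free; this file proves it for functions with values in a
complex Banach space `F`:

* `norm_dslope_le_div` — one division step: `f` holomorphic on a ball `⊃ closedBall 0 T`, `f 0 = 0`, `‖f‖ ≤ M` on `closedBall 0 T`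
  ⇒ `‖dslope f 0‖ ≤ M/T` on `closedBall 0 T` (maximum modulus for `(f z − f 0)/z`);
* `norm_le_mul_pow_of_iterate_dslope_eq_zero` — if the first `k` iterated divided differences of `f` at `0` vanish (`f` vanishes to
  order `k`), then `‖f z‖ ≤ M (‖z‖/T)^k` on the closed ball (Schwarz-lemma form of the Cauchy estimates; no factorials, no `2π`);
* `norm_le_of_order_one/two/three` — the same with the hypotheses spelled as `f 0 = 0`, `deriv f 0 = 0`, `deriv (dslope f 0) 0 = 0`;
* `norm_le_two_param_of_vanishing` — **the two-parameter cubic estimate**: for `f : ℂ → ℂ → F` separately holomorphic on a polydisc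
  `⊃ closedBall 0 T × closedBall 0 S` (`T, S ≥ 1`), bounded by `M` there, with `f 0 0 = 0`, `∂_t f(0,0) = 0`, `∂_s f(0,0) = 0` and the second
  divided `t`-difference at `(0,0)` zero: `‖f 1 1‖ ≤ M/T³ + 4M/(T·S) + M/S²` — the monomials `t³, ts, s²` and higher, as in E5D-NOTE (E5d).

References: J. Feldman, H. Knörrer, E. Trubowitz, Commun. Math. Phys. 247 (2004) 243–319 (arXiv:math-ph/0209046), Thm VI; HOME/p1/E5D-NOTE.md.
Standard complex analysis (Schwarz lemma / Cauchy estimates via the maximum modulus principle, `Complex.norm_le_of_forall_mem_frontier_norm_le`).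
-/

noncomputable section

namespace Summit.HubbardSuperconductivity.HubbardSuperconductivity.Theorems.VanishingOrderBound

set_option linter.dupNamespace false -- summit = problem name (single-conjunct summit), D-0017

open Metric Set Function

variable {F : Type*} [NormedAddCommGroup F] [NormedSpace ℂ F] [CompleteSpace F]

/-! ### §1 One complex parameter -/

omit [CompleteSpace F] in
/-- For `f 0 = 0`: `f z = z • dslope f 0 z`. [folklore] -/
theorem eq_smul_dslope_of_zero {f : ℂ → F} (h0 : f 0 = 0) (z : ℂ) : f z = z • dslope f 0 z := by
  have h := sub_smul_dslope f 0 z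
  rw [sub_zero, h0, sub_zero] at h
  exact h.symm

/-- **One division step** (maximum modulus for the divided difference): if `f` is holomorphic on `ball 0 R ⊃ closedBall 0 T`,
`f 0 = 0` and `‖f z‖ ≤ M` on `closedBall 0 T`, then `‖dslope f 0 z‖ ≤ M / T` on `closedBall 0 T`. [folklore] -/
theorem norm_dslope_le_div {f : ℂ → F} {R T M : ℝ} (hT : 0 < T) (hTR : T < R) (hf : DifferentiableOn ℂ f (ball 0 R))
    (h0 : f 0 = 0) (hM : ∀ z ∈ closedBall (0 : ℂ) T, ‖f z‖ ≤ M) :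
    ∀ z ∈ closedBall (0 : ℂ) T, ‖dslope f 0 z‖ ≤ M / T := by
  have hg : DifferentiableOn ℂ (dslope f 0) (ball 0 R) :=
    (Complex.differentiableOn_dslope (ball_mem_nhds (0 : ℂ) (hT.trans hTR))).2 hf
  have hgc : DiffContOnCl ℂ (dslope f 0) (ball (0 : ℂ) T) := hg.diffContOnCl_ball (closedBall_subset_ball hTR)
  intro z hz
  refine Complex.norm_le_of_forall_mem_frontier_norm_le isBounded_ball hgc (fun w hw => ?_)
    (by rw [closure_ball (0 : ℂ) hT.ne']; exact hz)
  rw [frontier_ball (0 : ℂ) hT.ne'] at hw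
  have hw' : ‖w‖ = T := by simpa using hw
  have hwne : w ≠ 0 := by
    intro h; rw [h, norm_zero] at hw'; exact hT.ne' hw'.symm |>.elim
  have key : dslope f 0 w = w⁻¹ • f w := by
    rw [eq_smul_dslope_of_zero h0 w, smul_smul, inv_mul_cancel₀ hwne, one_smul]
  rw [key, norm_smul, norm_inv, hw']
  have hfw := hM w (sphere_subset_closedBall hw)
  calc T⁻¹ * ‖f w‖ ≤ T⁻¹ * M := by gcongr
    _ = M / T := by ring

/-- **Vanishing to order `k` ⇒ `‖f z‖ ≤ M (‖z‖/T)^k`** (Schwarz-lemma form of the Cauchy estimates): if `f` is holomorphic on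
`ball 0 R ⊃ closedBall 0 T`, bounded by `M` on `closedBall 0 T`, and its first `k` iterated divided differences at `0` vanish
(`(dslope · 0)^[j] f 0 = 0` for `j < k`, i.e. `f(0) = f′(0) = … = 0` to order `k`), then `‖f z‖ ≤ M (‖z‖/T)^k` on `closedBall 0 T`.
[folklore] -/
theorem norm_le_mul_pow_of_iterate_dslope_eq_zero {R T : ℝ} (hT : 0 < T) (hTR : T < R) (k : ℕ) :
    ∀ {f : ℂ → F} {M : ℝ}, DifferentiableOn ℂ f (ball 0 R) →
      (∀ j < k, ((fun g : ℂ → F => dslope g 0)^[j] f) 0 = 0) →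
      (∀ z ∈ closedBall (0 : ℂ) T, ‖f z‖ ≤ M) → ∀ z ∈ closedBall (0 : ℂ) T, ‖f z‖ ≤ M * (‖z‖ / T) ^ k := by
  induction k with
  | zero =>
    intro f M _ _ hM z hz
    simpa using hM z hz
  | succ k ih =>
    intro f M hf hvan hM z hz
    have h0 : f 0 = 0 := by simpa using hvan 0 (Nat.succ_pos k)
    have hgd : DifferentiableOn ℂ (dslope f 0) (ball 0 R) :=
      (Complex.differentiableOn_dslope (ball_mem_nhds (0 : ℂ) (hT.trans hTR))).2 hf
    have hvan' : ∀ j < k, ((fun g : ℂ → F => dslope g 0)^[j] (dslope f 0)) 0 = 0 := by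
      intro j hj
      have := hvan (j + 1) (by omega)
      rwa [Function.iterate_succ_apply] at this
    have hg := norm_dslope_le_div hT hTR hf h0 hM
    have hgz := ih hgd hvan' hg z hz
    rw [eq_smul_dslope_of_zero h0 z, norm_smul]
    calc ‖z‖ * ‖dslope f 0 z‖ ≤ ‖z‖ * (M / T * (‖z‖ / T) ^ k) := by gcongr
      _ = M * (‖z‖ / T) ^ (k + 1) := by rw [pow_succ]; ring

/-- Order one: `f 0 = 0` ⇒ `‖f z‖ ≤ M ‖z‖/T`. [folklore] -/
theorem norm_le_of_order_one {f : ℂ → F} {R T M : ℝ} (hT : 0 < T) (hTR : T < R) (hf : DifferentiableOn ℂ f (ball 0 R))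
    (h0 : f 0 = 0) (hM : ∀ z ∈ closedBall (0 : ℂ) T, ‖f z‖ ≤ M) :
    ∀ z ∈ closedBall (0 : ℂ) T, ‖f z‖ ≤ M * (‖z‖ / T) := by
  have h := norm_le_mul_pow_of_iterate_dslope_eq_zero hT hTR 1 hf (fun j hj => by
    interval_cases j; simpa using h0) hM
  simpa using h

/-- Order two: `f 0 = 0`, `deriv f 0 = 0` ⇒ `‖f z‖ ≤ M (‖z‖/T)²`. [folklore] -/
theorem norm_le_of_order_two {f : ℂ → F} {R T M : ℝ} (hT : 0 < T) (hTR : T < R) (hf : DifferentiableOn ℂ f (ball 0 R))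
    (h0 : f 0 = 0) (h1 : deriv f 0 = 0) (hM : ∀ z ∈ closedBall (0 : ℂ) T, ‖f z‖ ≤ M) :
    ∀ z ∈ closedBall (0 : ℂ) T, ‖f z‖ ≤ M * (‖z‖ / T) ^ 2 :=
  norm_le_mul_pow_of_iterate_dslope_eq_zero hT hTR 2 hf (fun j hj => by
    interval_cases j
    · simpa using h0
    · simpa [dslope_same] using h1) hM

/-- Order three: `f 0 = 0`, `deriv f 0 = 0` and `deriv (dslope f 0) 0 = 0` (the second divided difference — for holomorphic `f`
this is `f″(0)/2`) ⇒ `‖f z‖ ≤ M (‖z‖/T)³`. [folklore] -/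
theorem norm_le_of_order_three {f : ℂ → F} {R T M : ℝ} (hT : 0 < T) (hTR : T < R) (hf : DifferentiableOn ℂ f (ball 0 R))
    (h0 : f 0 = 0) (h1 : deriv f 0 = 0) (h2 : deriv (dslope f 0) 0 = 0) (hM : ∀ z ∈ closedBall (0 : ℂ) T, ‖f z‖ ≤ M) :
    ∀ z ∈ closedBall (0 : ℂ) T, ‖f z‖ ≤ M * (‖z‖ / T) ^ 3 :=
  norm_le_mul_pow_of_iterate_dslope_eq_zero hT hTR 3 hf (fun j hj => by
    interval_cases j
    · simpa using h0
    · simpa [dslope_same] using h1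
    · simpa [dslope_same] using h2) hM

/-! ### §2 Two complex parameters: the cubic estimate of Lemma E.5d -/

/-- **The two-parameter cubic estimate** (E5D-NOTE §1): let `f : ℂ → ℂ → F` be separately holomorphic on `ball 0 R` in each variable
for the other in the closed polydisc `closedBall 0 T × closedBall 0 S` (`1 ≤ T, S < R`), with `‖f t s‖ ≤ M` there. If
`f 0 0 = 0` (no constant term), `∂_t f (0,0) = 0` (no `t`), `∂_s f(0,0) = 0` (no `s`) and the second divided `t`-difference of `t ↦ f t 0`
vanishes at `0` (no `t²`), then `‖f 1 1‖ ≤ M/T³ + 4M/(TS) + M/S²`: only the monomials `≥ t³`, `≥ ts`, `≥ s²` survive, each paid at the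
Cauchy rate.  With `T ≍ α/(64n₄)`, `S ≍ α/(64n₆)` this is (E5d): the remainder is cubic in the couplings.
[cite: FeldmanKnorrerTrubowitz2004OverlappingLoops, Thm VI (ii) — the quadratic bound this estimate upgrades] -/
theorem norm_le_two_param_of_vanishing {f : ℂ → ℂ → F} {R T S M : ℝ} (hT : 1 ≤ T) (hS : 1 ≤ S) (hTR : T < R) (hSR : S < R)
    (hft : ∀ s ∈ closedBall (0 : ℂ) S, DifferentiableOn ℂ (fun t => f t s) (ball 0 R))
    (hfs : ∀ t ∈ closedBall (0 : ℂ) T, DifferentiableOn ℂ (fun s => f t s) (ball 0 R))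
    (hM : ∀ t ∈ closedBall (0 : ℂ) T, ∀ s ∈ closedBall (0 : ℂ) S, ‖f t s‖ ≤ M)
    (h00 : f 0 0 = 0) (h10 : deriv (fun t => f t 0) 0 = 0) (h20 : deriv (dslope (fun t => f t 0) 0) 0 = 0)
    (h01 : deriv (fun s => f 0 s) 0 = 0) :
    ‖f 1 1‖ ≤ M / T ^ 3 + 4 * M / (T * S) + M / S ^ 2 := by
  have hT0 : 0 < T := by linarith
  have hS0 : 0 < S := by linarith
  have h0T : (0 : ℂ) ∈ closedBall (0 : ℂ) T := by simp [hT0.le]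
  have h0S : (0 : ℂ) ∈ closedBall (0 : ℂ) S := by simp [hS0.le]
  have h1T : (1 : ℂ) ∈ closedBall (0 : ℂ) T := by simpa using hT
  have h1S : (1 : ℂ) ∈ closedBall (0 : ℂ) S := by simpa using hS
  have hM0 : 0 ≤ M := le_trans (norm_nonneg _) (hM 0 h0T 0 h0S)
  -- (1) the pure-`t` part `ψ t = f t 0`: vanishing to order three
  have hψ : ‖f 1 0‖ ≤ M / T ^ 3 := by
    have h := norm_le_of_order_three hT0 hTR (hft 0 h0S) h00 h10 h20 (fun z hz => hM z hz 0 h0S) 1 h1T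
    calc ‖f 1 0‖ ≤ M * (‖(1 : ℂ)‖ / T) ^ 3 := h
      _ = M / T ^ 3 := by rw [norm_one]; ring
  -- (2) the pure-`s` part `φ s = f 0 s`: vanishing to order two
  have hφ : ‖f 0 1‖ ≤ M / S ^ 2 := by
    have h := norm_le_of_order_two hS0 hSR (hfs 0 h0T) h00 h01 (fun z hz => hM 0 h0T z hz) 1 h1S
    calc ‖f 0 1‖ ≤ M * (‖(1 : ℂ)‖ / S) ^ 2 := h
      _ = M / S ^ 2 := by rw [norm_one]; ring
  -- (3) the mixed difference `E t s = f t s - f t 0 - f 0 s + f 0 0` vanishes on both axes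
  set E : ℂ → ℂ → F := fun t s => f t s - f t 0 - f 0 s + f 0 0 with hE
  have hEbound : ∀ t ∈ closedBall (0 : ℂ) T, ∀ s ∈ closedBall (0 : ℂ) S, ‖E t s‖ ≤ 4 * M := by
    intro t ht s hs
    calc ‖E t s‖ ≤ ‖f t s - f t 0 - f 0 s‖ + ‖f 0 0‖ := norm_add_le _ _
      _ ≤ (‖f t s - f t 0‖ + ‖f 0 s‖) + ‖f 0 0‖ := by gcongr; exact norm_sub_le _ _
      _ ≤ ((‖f t s‖ + ‖f t 0‖) + ‖f 0 s‖) + ‖f 0 0‖ := by gcongr; exact norm_sub_le _ _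
      _ ≤ ((M + M) + M) + M := by
          gcongr
          · exact hM t ht s hs
          · exact hM t ht 0 h0S
          · exact hM 0 h0T s hs
          · exact hM 0 h0T 0 h0S
      _ = 4 * M := by ring
  -- first in `s` (for each fixed `t`), then in `t`
  have hEs : ∀ t ∈ closedBall (0 : ℂ) T, ∀ s ∈ closedBall (0 : ℂ) S, ‖E t s‖ ≤ 4 * M * (‖s‖ / S) := by
    intro t ht
    have hd : DifferentiableOn ℂ (fun s => E t s) (ball 0 R) := by
      simp only [hE]
      exact (((hfs t ht).sub_const _).sub (hfs 0 h0T)).add_const _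
    have hz : E t 0 = 0 := by simp [hE]
    exact norm_le_of_order_one hS0 hSR hd hz (fun s hs => hEbound t ht s hs)
  have hEts : ∀ s ∈ closedBall (0 : ℂ) S, ∀ t ∈ closedBall (0 : ℂ) T, ‖E t s‖ ≤ 4 * M * (‖s‖ / S) * (‖t‖ / T) := by
    intro s hs
    have hd : DifferentiableOn ℂ (fun t => E t s) (ball 0 R) := by
      simp only [hE]
      exact (((hft s hs).sub (hft 0 h0S)).sub_const _).add_const _
    have hz : E 0 s = 0 := by simp [hE]
    exact norm_le_of_order_one hT0 hTR hd hz (fun t ht => hEs t ht s hs)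
  have hE11 : ‖E 1 1‖ ≤ 4 * M / (T * S) := by
    have h := hEts 1 h1S 1 h1T
    simp only [norm_one, one_div] at h
    calc ‖E 1 1‖ ≤ 4 * M * S⁻¹ * T⁻¹ := h
      _ = 4 * M / (T * S) := by field_simp
  -- assemble: `f 1 1 = f 1 0 + f 0 1 + E 1 1` since `f 0 0 = 0`
  have hsplit : f 1 1 = f 1 0 + f 0 1 + E 1 1 := by
    simp only [hE, h00, add_zero]; abel
  calc ‖f 1 1‖ = ‖f 1 0 + f 0 1 + E 1 1‖ := by rw [hsplit]
    _ ≤ ‖f 1 0‖ + ‖f 0 1‖ + ‖E 1 1‖ := norm_add₃_le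
    _ ≤ M / T ^ 3 + M / S ^ 2 + 4 * M / (T * S) := by gcongr
    _ = M / T ^ 3 + 4 * M / (T * S) + M / S ^ 2 := by ring

end Summit.HubbardSuperconductivity.HubbardSuperconductivity.Theorems.VanishingOrderBound

end
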